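import Literature.Barriers.AtomisticToContinuum.StrongPinningBreathersSemigroup
import Literature.MathematicalPhysics.KineticTheory.LangevinChainLyapunovDrift
import HarnessLib

/-!
# The Hairer–Mattingly chain: existence of the invariant measure from the Lyapunov function of Theorem 5.6

`Literature/Barriers/AtomisticToContinuum/` (D-0021 barrier catalogue), companion of
`StrongPinningBreathers.lean` (barrier fact `HairerMattingly2009_threeOscillators`). Hairer–Mattingly
2009 obtain the EXISTENCE half of "there exists a unique invariant measure" (abstract) for the
three-oscillator chain with `k > 3/2` from two printed results:

* Theorem 5.6: "If `k > 3/2` there exist a function `𝒱` and constants `c, C > 0` such that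
  `𝒱 ≥ cH^α - C` and such that `L𝒱 ≤ C - cH^{α'}` for some (positive) exponents `α, α'`"
  (the averaging construction of §4–§5, twenty pages);
* Proposition 5.1 (Kryloff–Bogoliouboff with such a Lyapunov function).

Proposition 5.1 is PROVED in `LangevinChainLyapunovDrift.lean` for the constructed transition
semigroup of every chain with confining potentials, and the Hairer–Mattingly chain is one
(`StrongPinningBreathersSemigroup.lean`). This file performs the printed deduction
"Thm 5.6 ⟹ existence" for the semigroup `homogeneouslyPinnedChainSemigroup`, for any number of
sites: `homogeneouslyPinnedChain_exists_invariant_of_lyapunov` — if `𝒱 ∈ C²` satisfies the two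
inequalities of Thm 5.6 (`c, C, α, α' > 0`) then there is an invariant probability measure `μ`,
which moreover integrates `H^{α'}` (`∫ cH^{α'} dμ ≤ 𝒱(z) + 2C`). Consequently
(`HairerMattingly2009_threeOscillators_existence_of_thm56`) the existence half of the barrier fact
follows from the statement of Thm 5.6 for `N = 3`, taken as an explicit hypothesis (Thm 5.6 is
not vendored as a named fact here, D-0026). What then remains of the fact is Thm 5.6 itself and
the uniqueness asserted in §1 ("follows quickly from the hypoellipticity of the generator and the
Hamiltonian structure").

## References

* M. Hairer, J. C. Mattingly, Comm. Pure Appl. Math. **62** (2009) 999–1032 (arXiv:0712.3884),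
  Abstract, §1, Prop. 5.1, Thm 5.6 and the first display of its proof (`e:U1`).
-/

noncomputable section

open MeasureTheory Filter Topology Set
open scoped NNReal ENNReal

namespace Literature.Barriers.AtomisticToContinuum.HeatConduction

open Literature.MathematicalPhysics.KineticTheory.HeatConduction

variable {k γ : ℝ} {N : ℕ} {T_L T_R : ℝ}

/-- Sublevel sets of a function dominating `cH^α - C` (`c, α > 0`) sit inside sublevel sets of the
energy: `{f ≤ R} ⊆ {H ≤ ((max (R + C) 0)/c)^{1/α}}`. [folklore] -/
theorem homogeneouslyPinnedChain_setOf_le_subset (hk : 0 < k) (γ : ℝ) (N : ℕ)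
    {f : PhaseSpace N → ℝ} {c C α : ℝ} (hc : 0 < c) (hα : 0 < α)
    (hf : ∀ x, c * (homogeneouslyPinnedChain k γ).hamiltonian N x ^ α - C ≤ f x) (R : ℝ) :
    {x | f x ≤ R} ⊆ {x | (homogeneouslyPinnedChain k γ).hamiltonian N x ≤ (max (R + C) 0 / c) ^ (1 / α)} := by
  intro x hx
  set H := (homogeneouslyPinnedChain k γ).hamiltonian N x with hH
  have hH0 : 0 ≤ H := homogeneouslyPinnedChain_hamiltonian_nonneg hk γ N x
  have h1 : c * H ^ α ≤ max (R + C) 0 := by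
    have := hf x
    have hx' : f x ≤ R := hx
    exact le_max_of_le_left (by linarith)
  have h2 : H ^ α ≤ max (R + C) 0 / c := by
    rw [le_div_iff₀ hc]; linarith
  have h3 : (H ^ α) ^ (1 / α) ≤ (max (R + C) 0 / c) ^ (1 / α) :=
    Real.rpow_le_rpow (Real.rpow_nonneg hH0 _) h2 (by positivity)
  have h4 : (H ^ α) ^ (1 / α) = H := by
    rw [← Real.rpow_mul hH0, mul_one_div_cancel hα.ne', Real.rpow_one]
  rw [h4] at h3
  exact h3

/-- **Existence of an invariant measure for the Hairer–Mattingly chain from a Theorem 5.6-type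
Lyapunov function** (HM 2009: Thm 5.6 + Prop. 5.1), for `k > 3/2`, `γ ≥ 0`, `N ≥ 1` sites,
`T_L, T_R ≥ 0`: if `𝒱 ∈ C²` and `c, C, α, α' > 0` satisfy `𝒱 ≥ cH^α - C` and `L𝒱 ≤ C - cH^{α'}`
pointwise, then the transition semigroup `homogeneouslyPinnedChainSemigroup` has an invariant
probability measure `μ`, and `∫ cH^{α'} dμ ≤ 𝒱(z) + 2C` for every `z`. Proof: `𝒱 + C ≥ cH^α ≥ 0`
is a proper `C²` function with `L(𝒱 + C) ≤ C - cH^{α'}`, and `W = cH^{α'}` is continuous,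
nonnegative, with compact sublevel sets (coercivity of `H`); apply
`OscillatorChain.IsConfining.exists_invariant_of_lyapunov_drift` (Prop. 5.1, proved).
[cite: HairerMattingly2009, Thm 5.6 and Prop 5.1] -/
theorem homogeneouslyPinnedChain_exists_invariant_of_lyapunov (hk : 3 / 2 < k) (hγ : 0 ≤ γ)
    (hN : 0 < N) (hTL : 0 ≤ T_L) (hTR : 0 ≤ T_R) {𝒱 : PhaseSpace N → ℝ} (h𝒱 : ContDiff ℝ 2 𝒱)
    {c C α α' : ℝ} (hc : 0 < c) (hC : 0 < C) (hα : 0 < α) (hα' : 0 < α')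
    (hlow : ∀ x, c * (homogeneouslyPinnedChain k γ).hamiltonian N x ^ α - C ≤ 𝒱 x)
    (hdrift : ∀ x, (homogeneouslyPinnedChain k γ).generator N T_L T_R 𝒱 x ≤
      C - c * (homogeneouslyPinnedChain k γ).hamiltonian N x ^ α') (z : PhaseSpace N) :
    ∃ μ : Measure (PhaseSpace N), IsProbabilityMeasure μ ∧
      (homogeneouslyPinnedChainSemigroup hk hγ hN hTL hTR).IsInvariant μ ∧
        ∫⁻ x, ENNReal.ofReal (c * (homogeneouslyPinnedChain k γ).hamiltonian N x ^ α') ∂μ ≤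
          ENNReal.ofReal (𝒱 z + C + C) := by
  set P := homogeneouslyPinnedChain k γ with hP
  have hk0 : 0 < k := by linarith
  have hH0 : ∀ x, 0 ≤ P.hamiltonian N x := homogeneouslyPinnedChain_hamiltonian_nonneg hk0 γ N
  have hHc : Continuous (P.hamiltonian N) := homogeneouslyPinnedChain_continuous_hamiltonian hk0.le γ N
  have hHcpt : ∀ E : ℝ, IsCompact {x : PhaseSpace N | P.hamiltonian N x ≤ E} :=
    homogeneouslyPinnedChain_isCompact_setOf_hamiltonian_le (by linarith) γ N
  -- the shifted Lyapunov function `𝒱 + C ≥ 0`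
  set 𝒱' : PhaseSpace N → ℝ := fun x => 𝒱 x - (-C) with h𝒱'def
  have h𝒱' : ContDiff ℝ 2 𝒱' := h𝒱.sub contDiff_const
  have h𝒱'0 : ∀ x, 0 ≤ 𝒱' x := fun x => by
    have h1 := hlow x
    have h2 : 0 ≤ c * P.hamiltonian N x ^ α := mul_nonneg hc.le (Real.rpow_nonneg (hH0 x) _)
    show 0 ≤ 𝒱 x - (-C)
    linarith
  have h𝒱'c : ∀ R : ℝ, IsCompact {x | 𝒱' x ≤ R} := fun R => by
    have hsub : {x | 𝒱' x ≤ R} ⊆ {x | 𝒱 x ≤ R - C} := fun x hx => by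
      have hx' : 𝒱 x - (-C) ≤ R := hx
      show 𝒱 x ≤ R - C
      linarith
    refine ((hHcpt _).of_isClosed_subset (isClosed_le h𝒱.continuous continuous_const)
      (homogeneouslyPinnedChain_setOf_le_subset hk0 γ N hc hα hlow (R - C))).of_isClosed_subset
      (isClosed_le h𝒱'.continuous continuous_const) hsub
  -- the coercive observable `W = cH^{α'}`
  set W : PhaseSpace N → ℝ := fun x => c * P.hamiltonian N x ^ α' with hWdef
  have hW : Continuous W := continuous_const.mul (hHc.rpow_const fun x => Or.inr hα'.le)
  have hW0 : ∀ x, 0 ≤ W x := fun x => mul_nonneg hc.le (Real.rpow_nonneg (hH0 x) _)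
  have hWc : ∀ R : ℝ, IsCompact {x | W x ≤ R} := fun R => by
    have hlowW : ∀ x, c * P.hamiltonian N x ^ α' - 0 ≤ W x := fun x => by simp [hWdef]
    exact (hHcpt _).of_isClosed_subset (isClosed_le hW continuous_const)
      (homogeneouslyPinnedChain_setOf_le_subset hk0 γ N hc hα' hlowW R)
  have hLV : ∀ x, P.generator N T_L T_R 𝒱' x ≤ C - W x := fun x => by
    rw [h𝒱'def, P.generator_sub_const N T_L T_R 𝒱 (-C)]
    exact hdrift x
  obtain ⟨μ, hμ, hinv, hb⟩ :=
    (homogeneouslyPinnedChain_isConfining hk hγ).exists_invariant_of_lyapunov_drift hN hTL hTR h𝒱'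
      h𝒱'0 h𝒱'c hW hW0 hWc hC.le hLV z
  refine ⟨μ, hμ, hinv, hb.trans (le_of_eq ?_)⟩
  congr 1
  show 𝒱 z - (-C) + C = 𝒱 z + C + C
  ring

/-- **The existence half of `HairerMattingly2009_threeOscillators` from Theorem 5.6.** If, as
Theorem 5.6 prints for the three-oscillator chain with `k > 3/2` (here: for all frictions `γ > 0`
and bath temperatures `T_L, T_R > 0`, the generality of the fact), there is a `C²` Lyapunov
function `𝒱` with `𝒱 ≥ cH^α - C` and `L𝒱 ≤ C - cH^{α'}` for some `c, C, α, α' > 0`, then the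
chain has a Markov semigroup (the constructed `homogeneouslyPinnedChainSemigroup`) with an
invariant probability measure. The hypothesis is the printed statement of Thm 5.6, NOT a named
fact of the tree; uniqueness (HM §1) is the other outstanding input of the barrier fact.
[cite: HairerMattingly2009, Thm 5.6 and Prop 5.1 and Abstract] -/
theorem HairerMattingly2009_threeOscillators_existence_of_thm56
    (h56 : ∀ k γ : ℝ, 3 / 2 < k → 0 < γ → ∀ T_L T_R : ℝ, 0 < T_L → 0 < T_R →
      ∃ (𝒱 : PhaseSpace 3 → ℝ) (c C α α' : ℝ), ContDiff ℝ 2 𝒱 ∧ 0 < c ∧ 0 < C ∧ 0 < α ∧ 0 < α' ∧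
        (∀ x, c * (homogeneouslyPinnedChain k γ).hamiltonian 3 x ^ α - C ≤ 𝒱 x) ∧
        (∀ x, (homogeneouslyPinnedChain k γ).generator 3 T_L T_R 𝒱 x ≤
          C - c * (homogeneouslyPinnedChain k γ).hamiltonian 3 x ^ α'))
    (k γ : ℝ) (hk : 3 / 2 < k) (hγ : 0 < γ) (T_L T_R : ℝ) (hTL : 0 < T_L) (hTR : 0 < T_R) :
    ∃ S : LangevinChainSemigroup (homogeneouslyPinnedChain k γ) 3 T_L T_R,
      ∃ μ : Measure (PhaseSpace 3), IsProbabilityMeasure μ ∧ S.IsInvariant μ := by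
  obtain ⟨𝒱, c, C, α, α', h𝒱, hc, hC, hα, hα', hlow, hdrift⟩ := h56 k γ hk hγ T_L T_R hTL hTR
  obtain ⟨μ, hμ, hinv, -⟩ := homogeneouslyPinnedChain_exists_invariant_of_lyapunov hk hγ.le
    (by norm_num : 0 < 3) hTL.le hTR.le h𝒱 hc hC hα hα' hlow hdrift 0
  exact ⟨_, μ, hμ, hinv⟩

end Literature.Barriers.AtomisticToContinuum.HeatConduction

end
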